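import Literature.NumberTheory.GaloisCohomology.RestrictedRamificationExtComparisonTateDual
import Literature.Algebra.Homology.DiscreteRepExtInternalHomPrecomp
import HarnessLib

/-!
# Naturality in `A` of the comparison `Extⁿ_{C_{G_S}}(A, Ē_S) ≃+ Hⁿ(G_S, M^{N_S})` — the hypothesis `hcmpG` of
# the `S`-restricted `Ш`-pairing on Milne's `Ext` road (Harari §16.2 (16.4), Lemma 17.21 (a); Milne ADT I Thm. 4.10 (a))

Topic `NumberTheory/GaloisCohomology`; namespace `Literature.NumberTheory.GaloisCohomology.RestrictedExt`.  Theorems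
only; no definition, no named fact, no instance, no `sorry`.  Sequel of `RestrictedRamificationExtComparison` (bsd-eis
-w7 g12: the object-level comparison `extAddEquivContinuousCohomologyOfTorsion N X … : Ext N X n ≃+ Hⁿ_cont(Γ, Y)` and its
`G_S`-form `extAddEquivRestrictedCohomology ρ S A ES … : Ext A ES n ≃+ restrictedCohomology ρ S n`), of
`RestrictedRamificationExtComparisonTateDual` (-w7 g12: the identification `e := tateDualSUnitsIsoD` and the instantiated
comparison `extAddEquivRestrictedCohomologyTateDual`) and of `Literature.Algebra.Homology.DiscreteRepExtInternalHomPrecomp`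
(-w7 g12: `extIhomAddEquivContinuousCohomology_precomp`, naturality of door-c4's comparison in the module `N`).

THE STATEMENT.  For a morphism `G : A' ⟶ A` of finite objects of `C_Γ` (killed by `m`, `m'`), an object `X` on whose
carrier `m •` and `m' •` are onto, discrete `Y ≅ Hom(A, X)`, `Y' ≅ Hom(A', X)` and a morphism `φ : Y ⟶ Y'` which is
`Hom(G, X) : F ↦ F ∘ G` under the two identifications (`hφ`), the comparisons intertwine `G^* : Extⁿ(A, X) → Extⁿ(A', X)`
(`x ↦ [G] ∘ x`) with `Hⁿ(φ)` (Mathlib's `ContinuousCohomology.map (id Γ) φ n`):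
**`extAddEquivContinuousCohomologyOfTorsion_precomp`**; at `Γ := G_S` with values in `restrictedCohomology`:
**`extAddEquivRestrictedCohomology_precomp`** — for `φ` the instantiator takes the map of `N_S`-invariants induced by a
morphism of discrete `Γ_K`-modules (the spelling `ContinuousCohomology.map (id G_S) (ContinuousRep.invariantsHom F) n` of
`poitouTate_shaRestricted_tateDual_natural`), and `hφ` is the one compatibility between `F`, `G` and the chosen
identifications `e`, `e'` (e.g. `G = F^D` and `e`, `e'` from `Hom(M^D, Ē_S) = M`).  This is the input `hcmpG` of
`ShaExtRoad.pairing_natural` (clause (N) of the `S`-restricted Poitou–Tate pairing, Milne I Thm. 4.10 (a)), lane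
«PT-Ш-S-TC» of crux `stmt-BirchSwinnertonDyer-19032` (cell bsd-eis, seat bsd-line-x1-p1-w7 gen 12, brick D4a file D2).
§3 checks `hφ` for the instantiation `e := tateDualSUnitsIsoD` (`A := ⟨M^{N_S}⟩`, module `ρ.tateDual n`) from the pointwise
adjointness `ι ((φ f) m') = ι (f (G m'))` in `K̄ˣ` — the shape of the adjointness hypothesis of
`poitouTate_shaRestricted_tateDual_natural_at` (N) — whence **`extAddEquivRestrictedCohomologyTateDual_precomp`**.

HONEST FRAMING: naturality of a comparison isomorphism; no duality theorem and no case of BSD is proved here.  AI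
formalisation, established only by the kernel check.

## References
* D. Harari, *Galois Cohomology and Class Field Theory*, Universitext (2020), §16.2 (16.4), Lemma 17.21 (a). [Harari2020]
* J. S. Milne, *Arithmetic Duality Theorems*, 2nd ed. (2006), I §0 Example 0.8, I Thm. 4.10 (a) and its proof (p. 58),
  I §4 p. 65 (functoriality). [MilneADT2006]
-/

noncomputable section

open CategoryTheory CategoryTheory.Abelian NumberField IsDedekindDomain
open Literature.Algebra.Homology Literature.Algebra.Homology.DiscreteRep
open Literature.NumberTheory.GaloisRepresentations
open scoped NumberField

namespace Literature.NumberTheory.GaloisCohomology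

namespace RestrictedExt

/-! ## §1 Object level, any compact `Γ` -/

section ObjectLevel

variable {Γ : Type} [Group Γ] [TopologicalSpace Γ] [IsTopologicalGroup Γ] [CompactSpace Γ]
  {N N' : DiscreteRepCat ℤ Γ} [hNfin : @Module.Finite ℤ N.obj.V _ _ N.obj.hV2]
  [hN'fin : @Module.Finite ℤ N'.obj.V _ _ N'.obj.hV2] (G : N' ⟶ N) (X : DiscreteRepCat ℤ Γ)

/-- **The object-level comparison `Extⁿ_{C_Γ}(N, X) ≃+ Hⁿ_cont(Γ, Y)` is natural in `N`**: for `G : N' ⟶ N`, discrete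
`Y ≅ Hom(N, X)`, `Y' ≅ Hom(N', X)` and `φ : Y ⟶ Y'` equal to `Hom(G, X)` under the identifications (`hφ`),
`Hⁿ(φ) (cmp_N x) = cmp_{N'} ([G] ∘ x)`. [cite: Harari2020, §16.2 (16.4) and Lemma 17.21 (a)][cite: MilneADT2006, I §0 Example 0.8] -/
theorem extAddEquivContinuousCohomologyOfTorsion_precomp {m m' : ℕ} (hN : ∀ a : N.obj.V, m • a = 0)
    (hN' : ∀ a : N'.obj.V, m' • a = 0) (hXm : ∀ x : X.obj.V, ∃ y, x = m • y) (hXm' : ∀ x : X.obj.V, ∃ y, x = m' • y)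
    {Y Y' : TopRep.{0} ℤ Γ} [DiscreteTopology Y.V] [DiscreteTopology Y'.V] (hY : IsDiscrete ((forgetTop ℤ Γ).obj Y))
    (hY' : IsDiscrete ((forgetTop ℤ Γ).obj Y')) (e : stdBase Y hY ≅ ihomObj N X) (e' : stdBase Y' hY' ≅ ihomObj N' X)
    (φ : Y ⟶ Y') (hφ : stdBaseMap hY hY' φ ≫ e'.hom = e.hom ≫ ihomPrecomp G X) (n : ℕ) (x : Ext N X n) :
    (ContinuousCohomology.map (ContinuousMonoidHom.id Γ) (X := Y) (Y := Y') φ n).hom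
        (extAddEquivContinuousCohomologyOfTorsion N X hN hXm Y hY e n x) =
      extAddEquivContinuousCohomologyOfTorsion N' X hN' hXm' Y' hY' e' n ((Ext.mk₀ G).comp x (zero_add n)) :=
  haveI := discreteTopology_discTopRep X
  extIhomAddEquivContinuousCohomology_precomp G (discTopRep X) (isDiscrete_discTopRep X)
    (@ext_stdComplex_X_eq_zero_of_torsion Γ _ _ _ _ N hNfin (discTopRep X) (discreteTopology_discTopRep X)
      (isDiscrete_discTopRep X) m hN hXm)
    (@ext_stdComplex_X_eq_zero_of_torsion Γ _ _ _ _ N' hN'fin (discTopRep X) (discreteTopology_discTopRep X)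
      (isDiscrete_discTopRep X) m' hN' hXm')
    hY hY' e e' φ hφ n x

/-- The same in `AddMonoidHom` form (`Hⁿ(φ) ∘ cmp_N = cmp_{N'} ∘ G^*`).
[cite: Harari2020, §16.2 (16.4) and Lemma 17.21 (a)] -/
theorem map_comp_extAddEquivContinuousCohomologyOfTorsion {m m' : ℕ} (hN : ∀ a : N.obj.V, m • a = 0)
    (hN' : ∀ a : N'.obj.V, m' • a = 0) (hXm : ∀ x : X.obj.V, ∃ y, x = m • y) (hXm' : ∀ x : X.obj.V, ∃ y, x = m' • y)
    {Y Y' : TopRep.{0} ℤ Γ} [DiscreteTopology Y.V] [DiscreteTopology Y'.V] (hY : IsDiscrete ((forgetTop ℤ Γ).obj Y))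
    (hY' : IsDiscrete ((forgetTop ℤ Γ).obj Y')) (e : stdBase Y hY ≅ ihomObj N X) (e' : stdBase Y' hY' ≅ ihomObj N' X)
    (φ : Y ⟶ Y') (hφ : stdBaseMap hY hY' φ ≫ e'.hom = e.hom ≫ ihomPrecomp G X) (n : ℕ) :
    (ContinuousCohomology.map (ContinuousMonoidHom.id Γ) (X := Y) (Y := Y') φ n).hom.toAddMonoidHom.comp
        (extAddEquivContinuousCohomologyOfTorsion N X hN hXm Y hY e n).toAddMonoidHom =
      (extAddEquivContinuousCohomologyOfTorsion N' X hN' hXm' Y' hY' e' n).toAddMonoidHom.comp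
        (((extFunctor n).map G.op).app X).hom := by
  ext x
  exact extAddEquivContinuousCohomologyOfTorsion_precomp G X hN hN' hXm hXm' hY hY' e e' φ hφ n x

end ObjectLevel

/-! ## §2 `Γ := G_S`, values in `restrictedCohomology` -/

section Restricted

variable {K : Type} [Field K] [NumberField K] {M M' : Type} [AddCommGroup M] [TopologicalSpace M]
  [DiscreteTopology M] [AddCommGroup M'] [TopologicalSpace M'] [DiscreteTopology M']
  (ρ : DiscreteGaloisModule K M) (ρ' : DiscreteGaloisModule K M') (S : Set (HeightOneSpectrum (𝓞 K)))
  {A A' : DiscreteRepCat ℤ (GaloisGroupUnramifiedOutside K S)} [hAfin : @Module.Finite ℤ A.obj.V _ _ A.obj.hV2]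
  [hA'fin : @Module.Finite ℤ A'.obj.V _ _ A'.obj.hV2] (G : A' ⟶ A)
  (ES : DiscreteRepCat ℤ (GaloisGroupUnramifiedOutside K S))

/-- **`hcmpG`: the comparison `cmp : Extⁿ_{C_{G_S}}(A, ES) ≃+ Hⁿ(G_S, M^{N_S})` is natural in `A`** — for `G : A' ⟶ A`,
a morphism `φ : M^{N_S} ⟶ M'^{N_S}` of the coefficient representations (e.g. induced by a morphism of discrete
`Γ_K`-modules) which is `Hom(G, ES)` under the identifications `e : M^{N_S} ≅ Hom(A, ES)`, `e' : M'^{N_S} ≅ Hom(A', ES)`,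
one has `Hⁿ(φ) (cmp x) = cmp' ([G] ∘ x)`. [cite: MilneADT2006, I Thm. 4.10 (a) (proof, p. 58) and §4 p. 65]
[cite: Harari2020, §16.2 (16.4), Lemma 17.21 (a)] -/
theorem extAddEquivRestrictedCohomology_precomp {m m' : ℕ} (hA : ∀ a : A.obj.V, m • a = 0)
    (hA' : ∀ a : A'.obj.V, m' • a = 0) (hES : ∀ x : ES.obj.V, ∃ y, x = m • y) (hES' : ∀ x : ES.obj.V, ∃ y, x = m' • y)
    (e : stdBase (ρ.quotientInvariants (ramificationSubgroup K S)).toTopRep (isDiscrete_quotientInvariants ρ S) ≅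
      ihomObj A ES)
    (e' : stdBase (ρ'.quotientInvariants (ramificationSubgroup K S)).toTopRep (isDiscrete_quotientInvariants ρ' S) ≅
      ihomObj A' ES)
    (φ : (ρ.quotientInvariants (ramificationSubgroup K S)).toTopRep ⟶
      (ρ'.quotientInvariants (ramificationSubgroup K S)).toTopRep)
    (hφ : stdBaseMap (isDiscrete_quotientInvariants ρ S) (isDiscrete_quotientInvariants ρ' S) φ ≫ e'.hom =
      e.hom ≫ ihomPrecomp G ES)
    (n : ℕ) (x : Ext A ES n) :
    (ContinuousCohomology.map (ContinuousMonoidHom.id (GaloisGroupUnramifiedOutside K S))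
        (X := (ρ.quotientInvariants (ramificationSubgroup K S)).toTopRep)
        (Y := (ρ'.quotientInvariants (ramificationSubgroup K S)).toTopRep) φ n).hom
        (extAddEquivRestrictedCohomology ρ S A ES hA hES e n x) =
      extAddEquivRestrictedCohomology ρ' S A' ES hA' hES' e' n ((Ext.mk₀ G).comp x (zero_add n)) :=
  extAddEquivContinuousCohomologyOfTorsion_precomp G ES hA hA' hES hES' (isDiscrete_quotientInvariants ρ S)
    (isDiscrete_quotientInvariants ρ' S) e e' φ hφ n x

end Restricted

/-! ## §3 `hφ` for `e := tateDualSUnitsIsoD`, from pointwise adjointness -/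

section TateDual

open Literature.NumberTheory.GaloisRepresentations.DiscreteGaloisModule

variable (K : Type) [Field K] [NumberField K] (S : Set (HeightOneSpectrum (𝓞 K))) (n n' : ℕ) [NeZero n] [NeZero n']
  {M M' : Type} [AddCommGroup M] [TopologicalSpace M] [DiscreteTopology M] [Finite M]
  [AddCommGroup M'] [TopologicalSpace M'] [DiscreteTopology M'] [Finite M']
  (ρ : DiscreteGaloisModule K M) (ρ' : DiscreteGaloisModule K M')

/-- **The compatibility `hφ` for `e := tateDualSUnitsIsoD`**: if a morphism `G : ⟨M'^{N_S}⟩ ⟶ ⟨M^{N_S}⟩` of `C_{G_S}` and a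
morphism `φ : (M^D)^{N_S} ⟶ (M'^{D})^{N_S}` of coefficient representations are ADJOINT — `ι ((φ f) m') = ι (f (G m'))` in `K̄ˣ`
for all `f ∈ (M^D)^{N_S}`, `m' ∈ M'^{N_S}` (`ι` the Kummer inclusions `μ ↪ K̄ˣ`) — then `φ ≫ e' = e ≫ Hom(G, Ē_S)`.
[cite: MilneADT2006, I Thm. 4.10 (a) and §4 p. 65 (functoriality for adjoint pairs)][cite: Harari2020, §16.2 (16.4)] -/
theorem stdBaseMap_comp_tateDualSUnitsIsoD_hom
    (hn : ∀ v : HeightOneSpectrum (𝓞 K), ((n : ℕ) : 𝓞 K) ∈ v.asIdeal → v ∈ S) (hM : ∀ m : M, n • m = 0)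
    (hur : ramificationSubgroup K S ≤ ContinuousRep.ker ρ)
    (hn' : ∀ v : HeightOneSpectrum (𝓞 K), ((n' : ℕ) : 𝓞 K) ∈ v.asIdeal → v ∈ S) (hM' : ∀ m' : M', n' • m' = 0)
    (hur' : ramificationSubgroup K S ≤ ContinuousRep.ker ρ')
    (G : ofContinuousRep (ρ'.quotientInvariants (ramificationSubgroup K S)) ⟶
      ofContinuousRep (ρ.quotientInvariants (ramificationSubgroup K S)))
    (φ : ((ρ.tateDual n).quotientInvariants (ramificationSubgroup K S)).toTopRep ⟶
      ((ρ'.tateDual n').quotientInvariants (ramificationSubgroup K S)).toTopRep)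
    (hGφ : ∀ (f : Representation.invariants ((ρ.tateDual n).toRepresentation.comp (ramificationSubgroup K S).subtype))
        (m' : Representation.invariants (ρ'.toRepresentation.comp (ramificationSubgroup K S).subtype)),
      kummerInclAddHom K n'
          ((show M' →+ MuCarrier K n' from
              ((φ.hom f : Representation.invariants
                  ((ρ'.tateDual n').toRepresentation.comp (ramificationSubgroup K S).subtype)) : TateDual K M' n'))
            (m' : M')) =
        kummerInclAddHom K n
          ((show M →+ MuCarrier K n from (f : TateDual K M n))
            ((G.hom.hom m' : Representation.invariants (ρ.toRepresentation.comp (ramificationSubgroup K S).subtype)) :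
              M))) :
    stdBaseMap (isDiscrete_quotientInvariants (ρ.tateDual n) S) (isDiscrete_quotientInvariants (ρ'.tateDual n') S) φ ≫
        (tateDualSUnitsIsoD K S n' ρ' hn' hM' hur').hom =
      (tateDualSUnitsIsoD K S n ρ hn hM hur).hom ≫
        ihomPrecomp G (ofContinuousRep (SUnits.sUnitsRestricted K S)) := by
  refine ObjectProperty.hom_ext _ (Rep.hom_ext (DFunLike.ext _ _ fun f => LinearMap.ext fun m' =>
    Subtype.ext (Subtype.ext ?_)))
  change ((((show _ →ₗ[ℤ] _ from ContHomDual.tateDualToHomSUnits K S n' ρ' hn' (φ.hom f)) m' :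
      Representation.invariants
        ((SUnits.sUnitsModule K S).toRepresentation.comp (ramificationSubgroup K S).subtype)) :
      SUnits.sUnitsSubmodule K S) : UnitsCarrier K) =
    ((((show _ →ₗ[ℤ] _ from ContHomDual.tateDualToHomSUnits K S n ρ hn f) (G.hom.hom m') :
      Representation.invariants
        ((SUnits.sUnitsModule K S).toRepresentation.comp (ramificationSubgroup K S).subtype)) :
      SUnits.sUnitsSubmodule K S) : UnitsCarrier K)
  rw [ContHomDual.coe_coe_tateDualToHomSUnits_apply, ContHomDual.coe_coe_tateDualToHomSUnits_apply]
  exact hGφ f m'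

/-- **`hcmpG` INSTANTIATED**: for adjoint `(G, φ)` as above, the comparisons
`extAddEquivRestrictedCohomologyTateDual` intertwine `G^*` on `Ext(⟨·^{N_S}⟩, ⟨Ē_S⟩)` with `Hʳ(G_S, φ)` on
`Hʳ(G_S, (·^D)^{N_S})`. [cite: MilneADT2006, I Thm. 4.10 (a) (proof, p. 58) and §4 p. 65][cite: Harari2020, Lemma 17.21 (a), §16.2 (16.4)] -/
theorem extAddEquivRestrictedCohomologyTateDual_precomp
    (hn : ∀ v : HeightOneSpectrum (𝓞 K), ((n : ℕ) : 𝓞 K) ∈ v.asIdeal → v ∈ S) (hM : ∀ m : M, n • m = 0)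
    (hur : ramificationSubgroup K S ≤ ContinuousRep.ker ρ)
    (hn' : ∀ v : HeightOneSpectrum (𝓞 K), ((n' : ℕ) : 𝓞 K) ∈ v.asIdeal → v ∈ S) (hM' : ∀ m' : M', n' • m' = 0)
    (hur' : ramificationSubgroup K S ≤ ContinuousRep.ker ρ')
    (G : ofContinuousRep (ρ'.quotientInvariants (ramificationSubgroup K S)) ⟶
      ofContinuousRep (ρ.quotientInvariants (ramificationSubgroup K S)))
    (φ : ((ρ.tateDual n).quotientInvariants (ramificationSubgroup K S)).toTopRep ⟶
      ((ρ'.tateDual n').quotientInvariants (ramificationSubgroup K S)).toTopRep)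
    (hGφ : ∀ (f : Representation.invariants ((ρ.tateDual n).toRepresentation.comp (ramificationSubgroup K S).subtype))
        (m' : Representation.invariants (ρ'.toRepresentation.comp (ramificationSubgroup K S).subtype)),
      kummerInclAddHom K n'
          ((show M' →+ MuCarrier K n' from
              ((φ.hom f : Representation.invariants
                  ((ρ'.tateDual n').toRepresentation.comp (ramificationSubgroup K S).subtype)) : TateDual K M' n'))
            (m' : M')) =
        kummerInclAddHom K n
          ((show M →+ MuCarrier K n from (f : TateDual K M n))
            ((G.hom.hom m' : Representation.invariants (ρ.toRepresentation.comp (ramificationSubgroup K S).subtype)) :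
              M)))
    (r : ℕ) (x : Ext (ofContinuousRep (ρ.quotientInvariants (ramificationSubgroup K S)))
      (ofContinuousRep (SUnits.sUnitsRestricted K S)) r) :
    (ContinuousCohomology.map (ContinuousMonoidHom.id (GaloisGroupUnramifiedOutside K S))
        (X := ((ρ.tateDual n).quotientInvariants (ramificationSubgroup K S)).toTopRep)
        (Y := ((ρ'.tateDual n').quotientInvariants (ramificationSubgroup K S)).toTopRep) φ r).hom
        (extAddEquivRestrictedCohomologyTateDual K S n ρ hn hM hur r x) =
      extAddEquivRestrictedCohomologyTateDual K S n' ρ' hn' hM' hur' r ((Ext.mk₀ G).comp x (zero_add r)) :=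
  extAddEquivRestrictedCohomology_precomp (ρ.tateDual n) (ρ'.tateDual n') S G (ofContinuousRep (SUnits.sUnitsRestricted K S))
    (nsmul_obj_ofContinuousRep_quotientInvariants_eq_zero K S n ρ hM)
    (nsmul_obj_ofContinuousRep_quotientInvariants_eq_zero K S n' ρ' hM')
    (exists_eq_nsmul_sUnitsRestricted_of_mem K S n (NeZero.ne n) hn)
    (exists_eq_nsmul_sUnitsRestricted_of_mem K S n' (NeZero.ne n') hn')
    (tateDualSUnitsIsoD K S n ρ hn hM hur) (tateDualSUnitsIsoD K S n' ρ' hn' hM' hur') φ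
    (stdBaseMap_comp_tateDualSUnitsIsoD_hom K S n n' ρ ρ' hn hM hur hn' hM' hur' G φ hGφ) r x

end TateDual

end RestrictedExt

end Literature.NumberTheory.GaloisCohomology

end
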